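import Literature.Analysis.FluidPDE.DissipationAnomalyProofs
import Literature.Analysis.FluidPDE.DoeringFoiasProofs
import Literature.Analysis.FluidPDE.LongTimeAverageNonneg
import HarnessLib

/-!
# Witness enstrophy equals dissipation: `L²` weak-derivative witnesses of a Leray–Hopf solution
# and the long-time mean dissipation

For a Leray–Hopf solution `u` of NS_ν(f) on `T^d` the long-time mean dissipation of the tree is
the real `limsup` Cesàro average `meanDissipation ν u = limsup_T T⁻¹ ∫₀ᵀ ν ‖∇u(t)‖₂² dt` of the
SPECTRAL squared gradient norm `eGradNormSq (u t) = 4π² ∑ₖ |k|² |û(t,k)|²`. Route statements often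
carry instead an arbitrary family of `L²` WITNESSES `g t j` of the weak partial derivatives
`∂ⱼ u(t)` (a.e. `t`), measured in `ℝ≥0∞`. The two agree:

* `Torus.IsLerayHopfOn.ae_lintegral_witness_eq_eGradNormSq` — for a.e. `t ∈ (0, T)`,
  `∫⁻ ∑ⱼ ‖g t j‖ₑ² = eGradNormSq (u t)`: the weak gradient of a Leray–Hopf slice exists with this
  squared norm (`Torus.IsLerayHopfOn.exists_hasWeakGradient_holds`, Evans 2010 §5.9.2 / Parseval) and weak
  derivatives are unique (`Torus.HasWeakPartialDeriv.unique_holds`, Evans 2010 §5.2.1).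
* `Torus.IsLerayHopfOn.lintegral_witness_eq` — the time-integrated identity on `(0, T]`.
* `Torus.IsGlobalLerayHopf.timeMean_dissipation_eq` — for `T > 0` the Cesàro mean of the real
  dissipation integrand is `ν T⁻¹ (∫⁻_{(0,T)} ‖∇u‖₂²).toReal` (honest `toReal`).
* `Torus.IsGlobalLerayHopf.mul_le_meanDissipation_of_le_limsup_witness` — the BRIDGE: for a steady
  mean-zero force `f ∈ L²`, `ν > 0`, witnesses `g` as above and any real `M`, if
  `ofReal M ≤ limsup_T (ofReal T)⁻¹ ∫⁻_{(0,T]} ∫⁻ ∑ⱼ ‖g t j‖ₑ²` then `M ν ≤ meanDissipation ν u`.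
  The real `limsup` is a genuine one because the Cesàro means of the dissipation are bounded
  (`Torus.IsLerayHopfOn.intervalIntegral_power_bounds`, Doering–Foias 2002 §2), so it is the image of
  the `ℝ≥0∞` `limsup` under the monotone continuous truncated `toReal`.

References: L. C. Evans, *Partial Differential Equations*, 2nd ed., AMS 2010, §5.2.1 (uniqueness of
weak derivatives), §5.9.2 [Evans2010]; C. R. Doering, C. Foias, *Energy dissipation in body-forced
turbulence*, J. Fluid Mech. 467 (2002) 289–306, §2 (`ε = ν⟨‖∇u‖₂²⟩` as a long-time average, bounded
a priori for weak solutions) [DoeringFoias2002].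
-/

open MeasureTheory Filter Set Function
open scoped ENNReal NNReal RealInnerProductSpace

noncomputable section

namespace Literature.Analysis.FluidPDE

variable {d : Type*} [Fintype d] [DecidableEq d]

/-! ### Slice identity: witness enstrophy is the spectral dissipation -/

/-- **Witness enstrophy equals the spectral squared gradient norm, a.e. in time.** Along a
Leray–Hopf solution on `[0, T)`, if for a.e. `t ∈ (0, T)` the fields `g t j ∈ L²` are weak `j`-th
partial derivatives of `u t` (`j : d`), then for a.e. `t ∈ (0, T)`
`∫⁻ ∑ⱼ ‖g t j x‖ₑ² dx = eGradNormSq (u t)`. The Leray–Hopf slice has an integrable weak gradient `G t`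
with `∫⁻ |G t|² = eGradNormSq (u t)` (`Torus.IsLerayHopfOn.exists_hasWeakGradient_holds`), and
`g t j = G t · eⱼ` a.e. by uniqueness of weak derivatives (Evans 2010, §5.2.1). [cite: Evans2010, §5.2.1] -/
theorem Torus.IsLerayHopfOn.ae_lintegral_witness_eq_eGradNormSq {T ν : ℝ}
    {F u : ℝ → UnitAddTorus d → EuclideanSpace ℝ d} {u₀ : UnitAddTorus d → EuclideanSpace ℝ d}
    (hu : Torus.IsLerayHopfOn T ν F u₀ u) {g : ℝ → d → UnitAddTorus d → EuclideanSpace ℝ d}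
    (hg : ∀ᵐ t ∂(volume.restrict (Ioo 0 T)), ∀ j, MemLp (g t j) 2 volume ∧
      FunctionSpaces.Torus.HasWeakPartialDeriv j (u t) (g t j)) :
    ∀ᵐ t ∂(volume.restrict (Ioo 0 T)),
      ∫⁻ x, ∑ j, ‖g t j x‖ₑ ^ 2 = FunctionSpaces.Torus.eGradNormSq (u t) := by
  obtain ⟨G, -, hG⟩ := Torus.IsLerayHopfOn.exists_hasWeakGradient_holds hu
  filter_upwards [hG, hg] with t ht hgt
  obtain ⟨hwg, hGi, hGeq⟩ := ht
  have hae : ∀ j, g t j =ᵐ[volume] fun x => G t x (EuclideanSpace.single j 1) := fun j =>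
    FunctionSpaces.Torus.HasWeakPartialDeriv.unique_holds (EuclideanSpace ℝ d)
      ((hgt j).1.integrable one_le_two) (hGi.apply_continuousLinearMap _) (hgt j).2 (hwg j)
  rw [← hGeq]
  refine lintegral_congr_ae ?_
  filter_upwards [ae_all_iff.2 hae] with x hx
  rw [Torus.weakGradNormSq_eq_sum, ENNReal.ofReal_sum_of_nonneg (fun i _ => sq_nonneg _)]
  refine Finset.sum_congr rfl fun j _ => ?_
  rw [hx j, ← ofReal_norm, ENNReal.ofReal_pow (norm_nonneg _)]

/-- **Time-integrated witness identity**: along a Leray–Hopf solution on `[0, T)` with `L²` witnesses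
`g t j` of `∂ⱼ u(t)` for a.e. `t ∈ (0, T)`, `∫⁻_{t ∈ (0,T]} ∫⁻ ∑ⱼ ‖g t j‖ₑ² = ∫⁻_{t ∈ (0,T)} ‖∇u(t)‖₂²`
(`…ae_lintegral_witness_eq_eGradNormSq`; `(0,T]` versus `(0,T)` is immaterial for Lebesgue measure)
(Evans 2010, §5.2.1). [cite: Evans2010, §5.2.1] -/
theorem Torus.IsLerayHopfOn.lintegral_witness_eq {T ν : ℝ}
    {F u : ℝ → UnitAddTorus d → EuclideanSpace ℝ d} {u₀ : UnitAddTorus d → EuclideanSpace ℝ d}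
    (hu : Torus.IsLerayHopfOn T ν F u₀ u) {g : ℝ → d → UnitAddTorus d → EuclideanSpace ℝ d}
    (hg : ∀ᵐ t ∂(volume.restrict (Ioo 0 T)), ∀ j, MemLp (g t j) 2 volume ∧
      FunctionSpaces.Torus.HasWeakPartialDeriv j (u t) (g t j)) :
    ∫⁻ t in Ioc 0 T, ∫⁻ x, ∑ j, ‖g t j x‖ₑ ^ 2 =
      ∫⁻ t in Ioo 0 T, FunctionSpaces.Torus.eGradNormSq (u t) := by
  rw [← restrict_Ioo_eq_restrict_Ioc]
  exact lintegral_congr_ae (hu.ae_lintegral_witness_eq_eGradNormSq hg)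

/-! ### The Cesàro means of the dissipation -/

/-- **Honest Cesàro mean of the dissipation**: along a global Leray–Hopf solution, for `T > 0`,
`timeMean (t ↦ ν‖∇u(t)‖₂²) T = ν · (T⁻¹ (∫⁻_{(0,T)} ‖∇u‖₂²).toReal)`
(`Torus.IsLerayHopfOn.intervalIntegral_dissipation_eq`; Doering–Foias 2002, §2). [cite: DoeringFoias2002, §2] -/
theorem Torus.IsGlobalLerayHopf.timeMean_dissipation_eq {ν : ℝ}
    {F u : ℝ → UnitAddTorus d → EuclideanSpace ℝ d} {u₀ : UnitAddTorus d → EuclideanSpace ℝ d}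
    (hu : Torus.IsGlobalLerayHopf ν F u₀ u) {T : ℝ} (hT : 0 < T) :
    timeMean (fun t => ν * (FunctionSpaces.Torus.eGradNormSq (u t)).toReal) T =
      ν * (T⁻¹ * (∫⁻ t in Ioo 0 T, FunctionSpaces.Torus.eGradNormSq (u t)).toReal) := by
  simp only [timeMean]
  rw [((hu T hT).intervalIntegral_dissipation_eq hT).2]
  ring

/-- **Bounded Cesàro means of the dissipation** (Doering–Foias 2002, §2: for weak solutions the
running averages `T⁻¹∫₀ᵀ ν‖∇u‖₂²` are bounded uniformly in `T ≥ 1`): along a global Leray–Hopf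
solution with steady mean-zero force `f ∈ L²` and `ν > 0`, for `T ≥ 1`,
`T⁻¹ (∫⁻_{(0,T)} ‖∇u‖₂²).toReal ≤ (2·½‖u₀‖₂² + ‖f‖₂²/(4π²ν)) / ν`
(`Torus.IsLerayHopfOn.intervalIntegral_power_bounds`). [cite: DoeringFoias2002, §2] -/
theorem Torus.IsGlobalLerayHopf.inv_mul_toReal_lintegral_eGradNormSq_le {ν : ℝ}
    {f : UnitAddTorus d → EuclideanSpace ℝ d} {u : ℝ → UnitAddTorus d → EuclideanSpace ℝ d}
    {u₀ : UnitAddTorus d → EuclideanSpace ℝ d} (hu : Torus.IsGlobalLerayHopf ν (fun _ => f) u₀ u)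
    (hν : 0 < ν) (hf : MemLp f 2 volume) (hf0 : FunctionSpaces.Torus.HasZeroMean f)
    {T : ℝ} (hT : 1 ≤ T) :
    T⁻¹ * (∫⁻ t in Ioo 0 T, FunctionSpaces.Torus.eGradNormSq (u t)).toReal ≤
      (2 * FunctionSpaces.Torus.kineticEnergy u₀ +
        2 * ((4 * Real.pi ^ 2 * ν)⁻¹ / 2 * ∫ x, ‖f x‖ ^ 2)) / ν := by
  have hT0 : 0 < T := by linarith
  have hb := ((hu T hT0).intervalIntegral_power_bounds hT0 hν hf hf0).1
  rw [((hu T hT0).intervalIntegral_dissipation_eq hT0).2] at hb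
  set X : ℝ := (∫⁻ t in Ioo 0 T, FunctionSpaces.Torus.eGradNormSq (u t)).toReal with hX
  set E₀ : ℝ := FunctionSpaces.Torus.kineticEnergy u₀
  set A : ℝ := (4 * Real.pi ^ 2 * ν)⁻¹ / 2 * ∫ x, ‖f x‖ ^ 2
  have hE0 : 0 ≤ E₀ := FunctionSpaces.Torus.kineticEnergy_nonneg u₀
  have hX0 : 0 ≤ X := ENNReal.toReal_nonneg
  have hTi : 0 < T⁻¹ := inv_pos.2 hT0
  have hTi1 : T⁻¹ ≤ 1 := inv_le_one_of_one_le₀ hT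
  rw [le_div_iff₀ hν]
  -- `T⁻¹ X ν ≤ T⁻¹ (2E₀ + 2AT) = 2E₀ T⁻¹ + 2A ≤ 2E₀ + 2A`
  calc T⁻¹ * X * ν = T⁻¹ * (ν * X) := by ring
    _ ≤ T⁻¹ * (2 * E₀ + 2 * A * T) := mul_le_mul_of_nonneg_left hb hTi.le
    _ = 2 * E₀ * T⁻¹ + 2 * A * (T⁻¹ * T) := by ring
    _ = 2 * E₀ * T⁻¹ + 2 * A := by rw [inv_mul_cancel₀ hT0.ne', mul_one]
    _ ≤ 2 * E₀ * 1 + 2 * A := by nlinarith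
    _ = 2 * E₀ + 2 * A := by ring

/-! ### The bridge: a witness-enstrophy floor is a dissipation floor -/

/-- **Witness-enstrophy-to-dissipation bridge.** Let `u` be a global Leray–Hopf solution of
NS_ν(f) on `T^d` with steady mean-zero force `f ∈ L²`, `ν > 0`, and let `g t j ∈ L²` be weak `j`-th
partial derivatives of `u t` for a.e. `t > 0`. If `ofReal M ≤ limsup_T (ofReal T)⁻¹ ∫⁻_{(0,T]} ∫⁻ ∑ⱼ ‖g t j‖ₑ²`
(the `ℝ≥0∞` Cesàro `limsup` of the total witness enstrophy), then `M ν ≤ meanDissipation ν u`.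
Proof: the inner integral is `‖∇u(t)‖₂²` for a.e. `t` (`…lintegral_witness_eq`), the Cesàro means of
`ν‖∇u‖₂²` are `ν · toReal` of the `ℝ≥0∞` means (`…timeMean_dissipation_eq`) and bounded
(`…inv_mul_toReal_lintegral_eGradNormSq_le`), so the real `limsup` defining `meanDissipation` is the
image of the `ℝ≥0∞` one under the monotone continuous map `y ↦ ν (min y C).toReal`
(`Monotone.map_limsup_of_continuousAt`) (Doering–Foias 2002, §2; Evans 2010, §5.2.1). [cite: DoeringFoias2002, §2] -/
theorem Torus.IsGlobalLerayHopf.mul_le_meanDissipation_of_le_limsup_witness {ν : ℝ}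
    {f : UnitAddTorus d → EuclideanSpace ℝ d} {u : ℝ → UnitAddTorus d → EuclideanSpace ℝ d}
    {u₀ : UnitAddTorus d → EuclideanSpace ℝ d} (hu : Torus.IsGlobalLerayHopf ν (fun _ => f) u₀ u)
    (hν : 0 < ν) (hf : MemLp f 2 volume) (hf0 : FunctionSpaces.Torus.HasZeroMean f)
    {g : ℝ → d → UnitAddTorus d → EuclideanSpace ℝ d}
    (hg : ∀ᵐ t : ℝ, 0 < t → ∀ j, MemLp (g t j) 2 volume ∧
      FunctionSpaces.Torus.HasWeakPartialDeriv j (u t) (g t j))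
    {M : ℝ} (hM : ENNReal.ofReal M ≤ limsup (fun T : ℝ => (ENNReal.ofReal T)⁻¹ *
      ∫⁻ t in Ioc (0 : ℝ) T, ∫⁻ x, ∑ j, ‖g t j x‖ₑ ^ 2) atTop) :
    M * ν ≤ meanDissipation ν u := by
  rcases le_or_gt M 0 with hM0 | hM0
  · exact (mul_nonpos_iff.2 (Or.inr ⟨hM0, hν.le⟩)).trans (meanDissipation_nonneg hν.le u)
  -- notation
  set D : ℝ → ℝ := fun t => ν * (FunctionSpaces.Torus.eGradNormSq (u t)).toReal with hD
  set R : ℝ → ℝ := fun T => T⁻¹ * (∫⁻ t in Ioo 0 T, FunctionSpaces.Torus.eGradNormSq (u t)).toReal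
    with hR
  set Y : ℝ → ℝ≥0∞ := fun T => (ENNReal.ofReal T)⁻¹ *
    ∫⁻ t in Ioc (0 : ℝ) T, ∫⁻ x, ∑ j, ‖g t j x‖ₑ ^ 2 with hY
  set B : ℝ := (2 * FunctionSpaces.Torus.kineticEnergy u₀ +
    2 * ((4 * Real.pi ^ 2 * ν)⁻¹ / 2 * ∫ x, ‖f x‖ ^ 2)) / ν with hB
  set C : ℝ≥0∞ := ENNReal.ofReal B with hC
  -- the witnesses restricted to `(0, T)`
  have hg' : ∀ T, ∀ᵐ t ∂(volume.restrict (Ioo 0 T)), ∀ j, MemLp (g t j) 2 volume ∧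
      FunctionSpaces.Torus.HasWeakPartialDeriv j (u t) (g t j) := fun T =>
    (ae_restrict_iff' measurableSet_Ioo).2 (hg.mono fun t ht hmem => ht hmem.1)
  -- per-`T` identities
  have hfin : ∀ T, 0 < T → ∫⁻ t in Ioo 0 T, FunctionSpaces.Torus.eGradNormSq (u t) < ∞ :=
    fun T hT => (hu T hT).lintegral_eGradNormSq_lt_top
  have hR0 : ∀ T, 0 < T → 0 ≤ R T := fun T hT =>
    mul_nonneg (inv_nonneg.2 hT.le) ENNReal.toReal_nonneg
  have hYR : ∀ T, 0 < T → Y T = ENNReal.ofReal (R T) := fun T hT => by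
    simp only [hY, hR]
    rw [(hu T hT).lintegral_witness_eq (hg' T), ENNReal.ofReal_mul (inv_nonneg.2 hT.le),
      ENNReal.ofReal_inv_of_pos hT, ENNReal.ofReal_toReal (hfin T hT).ne]
  have hDR : ∀ T, 0 < T → timeMean D T = ν * R T := fun T hT => hu.timeMean_dissipation_eq hT
  have hRB : ∀ T, 1 ≤ T → R T ≤ B := fun T hT =>
    hu.inv_mul_toReal_lintegral_eGradNormSq_le hν hf hf0 hT
  -- the truncated `toReal`
  set φ : ℝ≥0∞ → ℝ := fun y => ν * (min y C).toReal with hφ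
  have hminC : ∀ y, min y C ≠ ∞ := fun y => ne_top_of_le_ne_top ENNReal.ofReal_ne_top (min_le_right _ _)
  have hφmono : Monotone φ := fun y y' hyy' =>
    mul_le_mul_of_nonneg_left (ENNReal.toReal_mono (hminC y') (min_le_min_right C hyy')) hν.le
  have hφcont : Continuous φ :=
    continuous_const.mul (ENNReal.continuousOn_toReal.comp_continuous
      (continuous_id.min continuous_const) fun y => hminC y)
  -- `timeMean D = φ ∘ Y` eventually
  have hev : ∀ᶠ T in atTop, timeMean D T = (φ ∘ Y) T := by
    filter_upwards [eventually_ge_atTop 1] with T hT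
    have hT0 : 0 < T := by linarith
    simp only [comp_apply, hφ]
    rw [hYR T hT0, min_eq_left (ENNReal.ofReal_le_ofReal (hRB T hT)), ENNReal.toReal_ofReal (hR0 T hT0),
      hDR T hT0]
  have hYC : ∀ᶠ T in atTop, Y T ≤ C := by
    filter_upwards [eventually_ge_atTop 1] with T hT
    have hT0 : 0 < T := by linarith
    rw [hYR T hT0]
    exact ENNReal.ofReal_le_ofReal (hRB T hT)
  have hLC : limsup Y atTop ≤ C := limsup_le_of_le (by isBoundedDefault) hYC
  have hMC : ENNReal.ofReal M ≤ C := hM.trans hLC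
  -- pass to the `limsup`
  have hlim : limsup (timeMean D) atTop = φ (limsup Y atTop) := by
    rw [limsup_congr hev]
    exact (hφmono.map_limsup_of_continuousAt Y hφcont.continuousAt).symm
  have hφM : φ (ENNReal.ofReal M) = M * ν := by
    simp only [hφ]
    rw [min_eq_left hMC, ENNReal.toReal_ofReal hM0.le, mul_comm]
  calc M * ν = φ (ENNReal.ofReal M) := hφM.symm
    _ ≤ φ (limsup Y atTop) := hφmono hM
    _ = limsup (timeMean D) atTop := hlim.symm
    _ = meanDissipation ν u := rfl

end Literature.Analysis.FluidPDE

end
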